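import Summits.ValiantsHypothesis.ValiantsHypothesis.Theorems.DefinabilityGapPivotLiveBad
import Summits.ValiantsHypothesis.ValiantsHypothesis.Theorems.DefinabilityGapPivotAdmissible
import Summits.ValiantsHypothesis.ValiantsHypothesis.Theorems.DefinabilityGapSparseSubfamily
import HarnessLib

/-!
# Definability gap, ROAD P: the free-cell dictionary for crowded lines (N1 v2 (c), deterministic)

The crowded-line bound `DefinabilityGapActiveShared.weight_fewFree_le` speaks about abstract
cells `j ∈ J`, killer sets `K j` and the activity predicate `fun j b => r b = τ j`.  This file
is the dictionary to the minors of ROAD P: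

* ROW `i` of the block of `c`: cells = column indices `j`, `K j = coCurves T c (i, j)`,
  `τ j = i`; COLUMN `j`: cells = row indices `a`, `K a = coCurves T c (a, j)`, `τ a = a`
  (`free_row_iff`, `free_col_iff` — definitional);
* a free cell is not a gadget zero (`not_mem_pivotZeros_of_free`, from
  `exists_of_mem_pivotZeros`), hence `#deadCols + #F ≤ m` for any set `F` of free columns of a
  row `i ≠ r c` (`card_deadCols_add_le`) and `#F ≤ #okRows + 1` for free rows of a column
  (`card_le_okRows_add_one`);
* the few-bad clauses of `KIPivotFewBad` follow from enough free cells: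
  `badRow_clause_of_free`, `badCol_clause_of_free`;
* every curve is a killer of at most two cells of a line (`card_filter_mem_coCurves_row_le_two`,
  `card_filter_mem_coCurves_col_le_two`) — the hypothesis `htwo` of `card_privFree_le` /
  `weight_fewFree_le`.
-/

namespace Summit.ValiantsHypothesis.ValiantsHypothesis.Theorems.DefinabilityGapPivotFreeDict

open Finset
open Literature.Computability.AlgebraicComplexity Literature.Computability.MetaComplexity
open Summit.ValiantsHypothesis.ValiantsHypothesis.Theorems.DefinabilityGapAffineRung
open Summit.ValiantsHypothesis.ValiantsHypothesis.Theorems.DefinabilityGapPivotCertificate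
open Summit.ValiantsHypothesis.ValiantsHypothesis.Theorems.DefinabilityGapPivotLive
open Summit.ValiantsHypothesis.ValiantsHypothesis.Theorems.DefinabilityGapPivotLiveWeak
open Summit.ValiantsHypothesis.ValiantsHypothesis.Theorems.DefinabilityGapPivotLiveBad
open Summit.ValiantsHypothesis.ValiantsHypothesis.Theorems.DefinabilityGapPivotAdmissible
open Summit.ValiantsHypothesis.ValiantsHypothesis.Theorems.DefinabilityGapSparseSubfamily

variable {m : ℕ}

/-! ## 1. The abstract `free` predicate, read on a row and on a column -/

/-- ROW dictionary: cell `j` of row `i` is `free` for killer sets `coCurves T c (i, ·)` and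
activity `r · = i` iff no co-curve through it is assigned row `i`. [this file] -/
theorem free_row_iff {T : Finset (Fin 3 → Fin (qOf m))} {c : Fin 3 → Fin (qOf m)}
    {r : (Fin 3 → Fin (qOf m)) → Fin m} {i j : Fin m} :
    free (fun j' => coCurves T c (i, j')) (fun _ c' => r c' = i) j ↔
      ∀ c' ∈ coCurves T c (i, j), r c' ≠ i := Iff.rfl

/-- COLUMN dictionary: cell `a` of column `j` is `free` for killer sets `coCurves T c (·, j)`
and activity `r · = a` iff no co-curve through it is assigned row `a`. [this file] -/
theorem free_col_iff {T : Finset (Fin 3 → Fin (qOf m))} {c : Fin 3 → Fin (qOf m)}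
    {r : (Fin 3 → Fin (qOf m)) → Fin m} {a j : Fin m} :
    free (fun a' => coCurves T c (a', j)) (fun a' c' => r c' = a') a ↔
      ∀ c' ∈ coCurves T c (a, j), r c' ≠ a := Iff.rfl

/-! ## 2. Free cells are not gadget zeros -/

/-- A cell `(i, j)` of the minor of `c` (`i ≠ r c`) none of whose co-curves is assigned row `i`
is not a gadget zero. [this file] -/
theorem not_mem_pivotZeros_of_free {T : Finset (Fin 3 → Fin (qOf m))} {s₀ : Fin m}
    {r : (Fin 3 → Fin (qOf m)) → Fin m} {c : Fin 3 → Fin (qOf m)} {i j : Fin m}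
    (hi : i ≠ r c) (hfree : ∀ c' ∈ coCurves T c (i, j), r c' ≠ i) :
    cellEmb m c (i, j) ∉ pivotZeros m T s₀ r := by
  intro h
  obtain ⟨c', hc'T, hne, hrc', he⟩ := exists_of_mem_pivotZeros hi h
  exact hfree c' (mem_coCurves.mpr ⟨hc'T, hne, he⟩) hrc'

/-- **Row count**: the killed cells of row `i ≠ r c` and any set `F` of free columns of that row
are disjoint, so `#deadCols + #F ≤ m`. [this file] -/
theorem card_deadCols_add_le (T : Finset (Fin 3 → Fin (qOf m))) (s₀ : Fin m)
    (r : (Fin 3 → Fin (qOf m)) → Fin m) (c : Fin 3 → Fin (qOf m)) {i : Fin m} (hi : i ≠ r c)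
    (F : Finset (Fin m)) (hF : ∀ j ∈ F, ∀ c' ∈ coCurves T c (i, j), r c' ≠ i) :
    (deadCols (pivotZeros m T s₀ r) c s₀ i).card + F.card ≤ m := by
  classical
  have hdisj : Disjoint (deadCols (pivotZeros m T s₀ r) c s₀ i) F := by
    rw [Finset.disjoint_left]
    intro j hj hjF
    exact not_mem_pivotZeros_of_free hi (hF j hjF) (mem_deadCols.mp hj).2
  have h := Finset.card_le_univ (deadCols (pivotZeros m T s₀ r) c s₀ i ∪ F)
  rw [Fintype.card_fin, Finset.card_union_of_disjoint hdisj] at h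
  exact h

/-- A free cell `(a, j)` with `a ≠ r c` is a free row of column `j` of the minor. [this file] -/
theorem mem_okRows_of_free {T : Finset (Fin 3 → Fin (qOf m))} {s₀ : Fin m}
    {r : (Fin 3 → Fin (qOf m)) → Fin m} {c : Fin 3 → Fin (qOf m)} {a j : Fin m}
    (ha : a ≠ r c) (hfree : ∀ c' ∈ coCurves T c (a, j), r c' ≠ a) :
    a ∈ okRows (pivotZeros m T s₀ r) c (r c) j :=
  mem_okRows.mpr ⟨ha, not_mem_pivotZeros_of_free ha hfree⟩

/-- **Column count**: any set `F` of free rows of column `j` satisfies `#F ≤ #okRows + 1` (the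
deleted row `r c` may belong to `F`). [this file] -/
theorem card_le_okRows_add_one (T : Finset (Fin 3 → Fin (qOf m))) (s₀ : Fin m)
    (r : (Fin 3 → Fin (qOf m)) → Fin m) (c : Fin 3 → Fin (qOf m)) (j : Fin m)
    (F : Finset (Fin m)) (hF : ∀ a ∈ F, ∀ c' ∈ coCurves T c (a, j), r c' ≠ a) :
    F.card ≤ (okRows (pivotZeros m T s₀ r) c (r c) j).card + 1 := by
  classical
  have hsub : F ⊆ okRows (pivotZeros m T s₀ r) c (r c) j ∪ {r c} := by
    intro a ha
    by_cases har : a = r c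
    · exact Finset.mem_union_right _ (Finset.mem_singleton.mpr har)
    · exact Finset.mem_union_left _ (mem_okRows_of_free har (hF a ha))
  exact (Finset.card_le_card hsub).trans
    ((Finset.card_union_le _ _).trans (by rw [Finset.card_singleton]))

/-! ## 3. The few-bad clauses from enough free cells -/

/-- **Bad-row clause of `KIPivotFewBad`**: if row `i ≠ r c` has more free columns than the block
has bad rows, then `#badRows + #deadCols i + 1 ≤ m`. [this file] -/
theorem badRow_clause_of_free (T : Finset (Fin 3 → Fin (qOf m))) (s₀ : Fin m)
    (r : (Fin 3 → Fin (qOf m)) → Fin m) (c : Fin 3 → Fin (qOf m)) {i : Fin m} (hi : i ≠ r c)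
    (F : Finset (Fin m)) (hF : ∀ j ∈ F, ∀ c' ∈ coCurves T c (i, j), r c' ≠ i)
    (hbig : (badRows (pivotZeros m T s₀ r) c (r c) s₀).card + 1 ≤ F.card) :
    (badRows (pivotZeros m T s₀ r) c (r c) s₀).card +
      (deadCols (pivotZeros m T s₀ r) c s₀ i).card + 1 ≤ m := by
  have h := card_deadCols_add_le T s₀ r c hi F hF
  omega

/-- **Bad-column clause of `KIPivotFewBad`**: if column `j` has at least `#badCols + 1` free rows,
then `#badCols ≤ #okRows j`. [this file] -/
theorem badCol_clause_of_free (T : Finset (Fin 3 → Fin (qOf m))) (s₀ : Fin m)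
    (r : (Fin 3 → Fin (qOf m)) → Fin m) (c : Fin 3 → Fin (qOf m)) (j : Fin m)
    (F : Finset (Fin m)) (hF : ∀ a ∈ F, ∀ c' ∈ coCurves T c (a, j), r c' ≠ a)
    (hbig : (badCols (pivotZeros m T s₀ r) c (r c) s₀).card + 1 ≤ F.card) :
    (badCols (pivotZeros m T s₀ r) c (r c) s₀).card ≤
      (okRows (pivotZeros m T s₀ r) c (r c) j).card := by
  have h := card_le_okRows_add_one T s₀ r c j F hF
  omega

/-! ## 4. A curve kills at most two cells of a line -/

/-- A curve is a co-curve of `c` at no more than two positions of a row. [this file] -/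
theorem card_filter_mem_coCurves_row_le_two (T : Finset (Fin 3 → Fin (qOf m)))
    (c c' : Fin 3 → Fin (qOf m)) (i : Fin m) (J : Finset (Fin m)) :
    (J.filter fun j => c' ∈ coCurves T c (i, j)).card ≤ 2 := by
  classical
  by_cases hcc' : c' = c
  · subst hcc'
    have h0 : (J.filter fun j => c' ∈ coCurves T c' (i, j)) = ∅ := by
      refine Finset.filter_false_of_mem fun j _ h => ?_
      exact (mem_coCurves.mp h).2.1 rfl
    rw [h0, Finset.card_empty]
    exact Nat.zero_le _
  refine le_trans ?_ (card_filter_pos_eq_le (m := m) hcc')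
  refine Finset.card_le_card_of_injOn (fun j => (i, j)) (fun j hj => ?_) (fun j _ j' _ h => ?_)
  · have h := (Finset.mem_filter.mp (Finset.mem_coe.mp hj)).2
    exact Finset.mem_coe.mpr (Finset.mem_filter.mpr ⟨Finset.mem_univ _, (mem_coCurves.mp h).2.2⟩)
  · exact congrArg Prod.snd h

/-- A curve is a co-curve of `c` at no more than two positions of a column. [this file] -/
theorem card_filter_mem_coCurves_col_le_two (T : Finset (Fin 3 → Fin (qOf m)))
    (c c' : Fin 3 → Fin (qOf m)) (j : Fin m) (R : Finset (Fin m)) :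
    (R.filter fun a => c' ∈ coCurves T c (a, j)).card ≤ 2 := by
  classical
  by_cases hcc' : c' = c
  · subst hcc'
    have h0 : (R.filter fun a => c' ∈ coCurves T c' (a, j)) = ∅ := by
      refine Finset.filter_false_of_mem fun a _ h => ?_
      exact (mem_coCurves.mp h).2.1 rfl
    rw [h0, Finset.card_empty]
    exact Nat.zero_le _
  refine le_trans ?_ (card_filter_pos_eq_le (m := m) hcc')
  refine Finset.card_le_card_of_injOn (fun a => (a, j)) (fun a ha => ?_) (fun a _ a' _ h => ?_)
  · have h := (Finset.mem_filter.mp (Finset.mem_coe.mp ha)).2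
    exact Finset.mem_coe.mpr (Finset.mem_filter.mpr ⟨Finset.mem_univ _, (mem_coCurves.mp h).2.2⟩)
  · exact congrArg Prod.fst h

end Summit.ValiantsHypothesis.ValiantsHypothesis.Theorems.DefinabilityGapPivotFreeDict
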